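import Summits.QuantumFields.YangMills.Theorems.BalabanUVNodesN21ProjectedCentreDilation
import Summits.QuantumFields.YangMills.Theorems.BalabanUVNodesN21DilationRoadAtRecord13CoPH
import Summits.QuantumFields.YangMills.Theorems.BalabanUVNodesN21CollarOddsBlockFrame
import Summits.QuantumFields.YangMills.Theorems.BalabanUVNodesN21LowCentreNonCollapse

/-!
# N21 (NE7c) · THE RE-CENTRED DILATION ROAD AS A `LevelLedger`: per live slot the cut law's (M1) from G28 P2
# `slotAntiConcentration_restrict_of_recentredDilation` (∕ G34 `…_of_projectedCentre` with `hmono` discharged), pushed through the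
# [dict] binders (`T4ShellMeasure.slot_field_of_antiConcentration`) and MONOTONISED to level letters `M_j ≥ (1+Q_s)∕κ₀,s`,
# `d_j ≥ #κ_s` ⇒ `T4ShellMeasureLevels.LevelLedger l₀ T A sh S piece lvl (j ↦ M_j·3(d_j+1)∕(1−ρ_j)) ρ` — EXACTLY the ledger shape
# `…N21DilationRoadAtRecord13CoPH` (p583987) keys at the Stage-13 record

Track A of `YM-PLAN.md` (cell `pub-ymgap`, HUMAN RULING D-0062 ∕ D-0149 width seats), node **N21**; WIDTH SEAT `pub-ymgap-dag-n21-w2`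
(gen 0), W-SEAT-START-LIST v3 §n21 ITEM 2 «`KeyedShellWeight cr` AT THE RECORD from n21-d ∕ n21-e outputs BY NAME — the KNIT at the record»,
file 4: the MEASURE-LEVEL half of the knit (file 1 p583987 is the END half).  THEOREMS ONLY: 0 `def`, 0 `sorry`, standard axioms;
COUNT-NEUTRAL; `--kind proof --supports stmt-QuantumFields-20544 --as helper`.  Imports n21-d's G34 `…N21ProjectedCentreDilation` (brings G28
`…N21RecentredDilationTransversal`, G32 `…N21ProjectedCentreNonCollapse`), n21-w2's file 1, and n21-e's 38j
`…N21CollarOddsBlockFrame` (§4's witness frame: `isFiniteMeasure_blockGaussianWeight` BY NAME).  Restates nothing; cites by name; n21-d's slot-level lemmas (G26 `slot_field_of_radialTransversal`, G28 `slot_field_of_recentredDilation`)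
are the ONE-SLOT versions of §1's `slot` field and are NOT re-declared.

WHY.  pub-balaban's `ShellMeasureRootComposition.levelLedger_of_slotAC` (consumed by n21-a's `s_N21_of_slotACReading`) builds a run's
`LevelLedger` from per-slot (M1) with constants BY LEVEL `D (lvl K s)`; the re-centred dilation road delivers per-SLOT constants
`3(#κ_s+1)(1+Q_s)∕(κ₀,s(1−ρ))` (block dimension, envelope odds and radial transversality vary slot by slot).  §1 monotonises them
(`T4ShellMeasureFibre.slotAntiConcentration_mono`) to the level letters of file 1's END — so «G28∕G34 per live slot + [dict] + (R) + level
letters» IS a `LevelLedger` in the dilation shape, and two of them feed file 1 §2 `shellWeightBound_of_levels_dilationCoeff` ∕ §3 (at the record)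
in ONE application each.

WHAT IS PROVED ([folklore]; one run, slot data indexed by `(K, t, s)` over measurable-space ∕ block-index families `X K s`, `κ K s`).
* §1 ★ `levelLedger_of_recentredDilation` — G28's generality: per live slot a product frame `X K s × (κ K s → ℝ)`, exterior law `ζ`, density
  `g`, centre `m`, statistic `U`, cut `C`, envelope `Env`, threshold `θ`, level width `ρ_{lvl}`, transversality `κ₀`, odds `Q`, the four road
  binders `henv ∕ hmono ∕ hRT ∕ hQ` DISPLAYED, the [dict] push `hpiece ∕ hAw` and (R); level letters `M_j`, `d_j` dominating `(1+Q)∕κ₀`, `#κ`.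
* §2 ★★ `levelLedger_of_projectedCentre` — G34's setting: the density `𝟙_{K}(w)·exp(−(½⟨w−μ, A(w−μ)⟩ + P z w))`, dilation about the
  A-projected centre `c`, `hmono` DISCHARGED by G32 `hmono_of_projectedCentre` (convex kept cut, `c ∈ K`, `P` `G`-Lipschitz, obtuse cross
  terms, `2G∕γ`-farness); remaining binders as in G34, per slot.
* §0 (v1.0's «§3, stated first») `dilationCoeff_ge_slotConst` — the arithmetic of the monotonisation (G26 `dilationConst_transversal_eq`'s identity, `mul_le_mul`).
* §5 (v1.1, APPEND-ONLY) ★★ `levelLedger_of_lowCentre` — G31's setting (`𝟙_{Kcut}·e^{−φ}`, `φ` convex, LOW centre `m ∈ Kcut`), `hmono` DISCHARGED per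
  slot by G30 `hmono_of_lowCentre` (+ import of G30 `…N21LowCentreNonCollapse`); remaining binders as G31, per slot.
* §4 A2 ∕ A6: `recentredDilationLedger_binders_inhabited` — EVERY binder of §1 discharged in the kernel on ONE LIVE SLOT per step (frame
  `Unit × (Fin 1 → ℝ)`, `dirac ()` × Gaussian weight, `m = 0`, `U = |w₀|`, `C = univ`, `Env = {U < 1}` so `hQ` holds with `Q = 0`, `θ = 1`,
  `ρ ≡ ½`, `κ₀ = 1`, [dict] with equality, `M ≡ d ≡ 1`) — §1 FIRES, on an instance whose ledger inequality is NUMERICALLY TRIVIAL (`D·ρ = 12·½ = 6 ≥ 1`: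
  a satisfiability witness for the binder LIST, not a sharpness test — ref-O g2 READ-41 NIT); `recentredDilationLedger_witness_live` (not the no-slot ledger).

HONEST FRAMING.  [textbook] measure theory BY NAME over n21-d's parts 28∕32∕34; every per-slot letter (frames, laws, densities, centres,
statistics, cuts, envelopes, thresholds, `κ₀`, `Q`, the [dict] constants) is a HYPOTHESIS — NODE O's term object; nothing of Bałaban's
asserted; NE7c NOT PRINTED ∕ NOT proved; N21 NOT discharged; counts UNMOVED (typed 28∕28 · discharged 5∕27); one finite four-torus
programme at fixed `ε` — NOT ℝ⁴, NOT infinite volume, NOT OS, NOT a mass gap, NOT Clay.  No decl below carries a cite tag.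
-/

set_option autoImplicit false

open MeasureTheory Set Finset
open scoped ENNReal

namespace Summit.QuantumFields.YangMills.Theorems.N21RecentredRoadLevelLedger

open Literature.MathematicalPhysics.QuantumFieldTheory.Balaban1983to89
open Literature.MathematicalPhysics.QuantumFieldTheory.Balaban1983to89.T4ShellMeasure
  (SlotAntiConcentration slot_field_of_antiConcentration)
open Literature.MathematicalPhysics.QuantumFieldTheory.Balaban1983to89.T4ShellMeasureFibre (slotAntiConcentration_mono)
open T4ShellMeasureLevels (LevelLedger)
open N21RecentredDilationTransversal (slotAntiConcentration_restrict_of_recentredDilation)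
open N21ProjectedCentreNonCollapse (hmono_of_projectedCentre)
open N21DilationRoadAtRecord13CoPH (dilationCoeffConst_nonneg)

/-! ## §0 the monotonisation arithmetic («§3, stated first» in v1.0; renumbered per ref-O g2 READ-41 — decl unchanged) -/

/-- **SLOT CONSTANT ≤ LEVEL CONSTANT**: `(1+Q)∕κ₀ ≤ M`, `0 ≤ #κ ≤ d`, `0 ≤ M`, `ρ < 1` ⇒
`3(#κ+1)(1+Q)∕(κ₀(1−ρ)) ≤ M·3(d+1)∕(1−ρ)` (G26 `dilationConst_transversal_eq`'s identity via `div_mul_div_comm`, then `mul_le_mul`). [folklore] -/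
theorem dilationCoeff_ge_slotConst {cardκ d Q κ₀ M ρ : ℝ} (hcard : 0 ≤ cardκ) (hd : cardκ ≤ d)
    (hM0 : 0 ≤ M) (hM : (1 + Q) / κ₀ ≤ M) (hρ : ρ < 1) :
    3 * (cardκ + 1) * (1 + Q) / (κ₀ * (1 - ρ)) ≤ M * (3 * (d + 1) / (1 - ρ)) := by
  have h1ρ : 0 < 1 - ρ := by linarith
  have e : (1 + Q) / κ₀ * (3 * (cardκ + 1) / (1 - ρ)) = 3 * (cardκ + 1) * (1 + Q) / (κ₀ * (1 - ρ)) := by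
    rw [div_mul_div_comm]
    ring_nf
  rw [← e]
  exact mul_le_mul hM (div_le_div_of_nonneg_right (by linarith) h1ρ.le) (div_nonneg (by linarith) h1ρ.le) hM0

/-! ## §1 One run: the re-centred road (G28 generality) as a level ledger -/

section OneRun

variable {ι σ : Type*} {X : ℕ → σ → Type*} [∀ K s, MeasurableSpace (X K s)] {κ : ℕ → σ → Type*}
  [∀ K s, Fintype (κ K s)] [∀ K s, Nonempty (κ K s)]
  {l₀ : ℝ} {T : ℕ → Finset ι} {A sh : ℕ → ℝ → ι → ℝ} {S : ℕ → Finset σ} {piece : ℕ → ℝ → σ → ι → ℝ}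
  {lvl : ℕ → σ → ℕ} {ρ Mlvl d : ℕ → ℝ} {θ κ₀ Q M₀ : ℕ → ℝ → σ → ℝ}

/-- ★ **THE RE-CENTRED DILATION ROAD IS A LEVEL LEDGER WITH DILATION CONSTANTS** (one run).  DATA per live slot `s ∈ S K` at source
`|t| ≤ l₀`: a product frame `X K s × (κ K s → ℝ)` with exterior law `ζ K t s` (s-finite), a measurable density `g K t s` whose cut law
`((ζ.prod vol).withDensity g)` is FINITE, a measurable centre `m K t s`, statistic `U K t s`, measurable cut `C K t s` and envelope
`Env K t s`, threshold `θ > 0`, level width `0 < ρ_{lvl} < 1`, transversality `κ₀ > 0`, odds `Q ≥ 0`; G28 P2's four binders at the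
slot (`henv ∕ hmono ∕ hRT ∕ hQ`); the [dict] push (`hpiece`: the slot's pieces weigh at most `M₀ ×` the cut law's shell mass below `θ`;
`hAw`: `M₀ ×` its total mass `≤ Σ_τ A`); (R) `0 ≤ sh ≤ A`, `cover`; level letters `0 ≤ M_j`, `0 ≤ d_j` with `(1+Q)∕κ₀ ≤ M_{lvl s}`,
`#κ_s ≤ d_{lvl s}`.  CONCLUSION: `LevelLedger l₀ T A sh S piece lvl (j ↦ M_j·3(d_j+1)∕(1−ρ_j)) ρ` — file 1 p583987's ledger shape
(G28 `slotAntiConcentration_restrict_of_recentredDilation` ∘ `slotAntiConcentration_mono` ∘ `slot_field_of_antiConcentration` per slot).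
HYPOTHESES only; NE7c NOT proved. [folklore] -/
theorem levelLedger_of_recentredDilation
    (ζ : ∀ (K : ℕ) (_t : ℝ) (s : σ), Measure (X K s)) (hζ : ∀ K t s, SFinite (ζ K t s))
    {m : ∀ (K : ℕ) (_t : ℝ) (s : σ), X K s → (κ K s → ℝ)} (hm : ∀ K t s, Measurable (m K t s))
    {g : ∀ (K : ℕ) (_t : ℝ) (s : σ), X K s × (κ K s → ℝ) → ℝ≥0∞} (hg : ∀ K t s, Measurable (g K t s))
    (hfin : ∀ K t, |t| ≤ l₀ → ∀ s ∈ S K, IsFiniteMeasure (((ζ K t s).prod volume).withDensity (g K t s)))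
    {U : ∀ (K : ℕ) (_t : ℝ) (s : σ), X K s × (κ K s → ℝ) → ℝ} (hUm : ∀ K t s, Measurable (U K t s))
    {C Env : ∀ (K : ℕ) (_t : ℝ) (s : σ), Set (X K s × (κ K s → ℝ))}
    (hC : ∀ K t s, MeasurableSet (C K t s)) (hEnv : ∀ K t s, MeasurableSet (Env K t s))
    (hθ : ∀ K t s, 0 < θ K t s) (hρ0 : ∀ j, 0 < ρ j) (hρ1 : ∀ j, ρ j < 1) (hκ : ∀ K t s, 0 < κ₀ K t s)
    (hQ0 : ∀ K t s, 0 ≤ Q K t s)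
    (henv : ∀ K t, |t| ≤ l₀ → ∀ s ∈ S K, ∀ l ∈ Icc (1 - 1 / ((Fintype.card (κ K s) : ℝ) + 1)) 1, ∀ p : X K s × (κ K s → ℝ),
      θ K t s * (1 - ρ (lvl K s)) ≤ U K t s p → U K t s p < θ K t s → p ∈ C K t s →
        (p.1, m K t s p.1 + l • (p.2 - m K t s p.1)) ∈ Env K t s)
    (hmono : ∀ K t, |t| ≤ l₀ → ∀ s ∈ S K, ∀ l ∈ Icc (1 - 1 / ((Fintype.card (κ K s) : ℝ) + 1)) 1, ∀ p : X K s × (κ K s → ℝ),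
      θ K t s * (1 - ρ (lvl K s)) ≤ U K t s p → U K t s p < θ K t s → p ∈ C K t s →
        g K t s p ≤ g K t s (p.1, m K t s p.1 + l • (p.2 - m K t s p.1)))
    (hRT : ∀ K t, |t| ≤ l₀ → ∀ s ∈ S K, ∀ p : X K s × (κ K s → ℝ), θ K t s * (1 - ρ (lvl K s)) ≤ U K t s p → U K t s p < θ K t s →
      p ∈ C K t s → ∀ r : ℝ, 1 ≤ r →
        θ K t s * (1 - ρ (lvl K s)) ≤ U K t s (p.1, m K t s p.1 + r • (p.2 - m K t s p.1)) →
        U K t s (p.1, m K t s p.1 + r • (p.2 - m K t s p.1)) < θ K t s → (p.1, m K t s p.1 + r • (p.2 - m K t s p.1)) ∈ C K t s →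
          U K t s p + κ₀ K t s * (θ K t s * (1 - ρ (lvl K s))) * (r - 1) ≤ U K t s (p.1, m K t s p.1 + r • (p.2 - m K t s p.1)))
    (hQ : ∀ K t, |t| ≤ l₀ → ∀ s ∈ S K, (((ζ K t s).prod volume).withDensity (g K t s)) (Env K t s \ ({p | U K t s p < θ K t s} ∩ C K t s))
      ≤ ENNReal.ofReal (Q K t s) * (((ζ K t s).prod volume).withDensity (g K t s)) ({p | U K t s p < θ K t s} ∩ C K t s))
    (hM₀ : ∀ K t, |t| ≤ l₀ → ∀ s ∈ S K, 0 ≤ M₀ K t s)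
    (hpiece : ∀ K t, |t| ≤ l₀ → ∀ s ∈ S K, ∑ τ ∈ T K, piece K t s τ ≤ M₀ K t s *
      (((((ζ K t s).prod volume).withDensity (g K t s)).restrict ({p | U K t s p < θ K t s} ∩ C K t s))
        {p | θ K t s * (1 - ρ (lvl K s)) ≤ U K t s p ∧ U K t s p < θ K t s}).toReal)
    (hAw : ∀ K t, |t| ≤ l₀ → ∀ s ∈ S K, M₀ K t s *
      (((((ζ K t s).prod volume).withDensity (g K t s)).restrict ({p | U K t s p < θ K t s} ∩ C K t s)) univ).toReal ≤
        ∑ τ ∈ T K, A K t τ)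
    (sh_nonneg : ∀ K t, |t| ≤ l₀ → ∀ τ ∈ T K, 0 ≤ sh K t τ) (sh_le : ∀ K t, |t| ≤ l₀ → ∀ τ ∈ T K, sh K t τ ≤ A K t τ)
    (cover : ∀ K t, |t| ≤ l₀ → ∀ τ ∈ T K, sh K t τ ≤ ∑ s ∈ S K, piece K t s τ)
    (hM0 : ∀ j, 0 ≤ Mlvl j) (hMlvl : ∀ K t, |t| ≤ l₀ → ∀ s ∈ S K, (1 + Q K t s) / κ₀ K t s ≤ Mlvl (lvl K s))
    (hd0 : ∀ j, 0 ≤ d j) (hd : ∀ K, ∀ s ∈ S K, (Fintype.card (κ K s) : ℝ) ≤ d (lvl K s)) :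
    LevelLedger l₀ T A sh S piece lvl (fun j => Mlvl j * (3 * (d j + 1) / (1 - ρ j))) ρ where
  sh_nonneg := sh_nonneg
  sh_le := sh_le
  cover := cover
  slot K t ht s hs := by
    haveI := hζ K t s
    haveI := hfin K t ht s hs
    have hac := slotAntiConcentration_restrict_of_recentredDilation (ζ K t s) (hm K t s) (hg K t s) (hUm K t s) (hC K t s)
      (hEnv K t s) (hθ K t s) (hρ0 _) (hρ1 _) (hκ K t s) (hQ0 K t s) (henv K t ht s hs) (hmono K t ht s hs) (hRT K t ht s hs)
      (hQ K t ht s hs)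
    have hle := dilationCoeff_ge_slotConst (Nat.cast_nonneg _) (hd K s hs) (hM0 _) (hMlvl K t ht s hs) (hρ1 (lvl K s))
    exact slot_field_of_antiConcentration (dilationCoeffConst_nonneg (hM0 _) (hd0 _) (hρ1 _)) (hρ0 _).le
      (slotAntiConcentration_mono (hρ0 _).le hle hac) (T K) (hM₀ K t ht s hs) (hpiece K t ht s hs) (hAw K t ht s hs)
  D_nonneg j := dilationCoeffConst_nonneg (hM0 j) (hd0 j) (hρ1 j)
  ρ_nonneg j := (hρ0 j).le

end OneRun

/-! ## §2 One run: G34's projected-centre setting, `hmono` discharged -/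

section ProjectedCentre

open Matrix

variable {ι σ : Type*} {X : ℕ → σ → Type*} [∀ K s, MeasurableSpace (X K s)] {κ : ℕ → σ → Type*}
  [∀ K s, Fintype (κ K s)] [∀ K s, Nonempty (κ K s)]
  {l₀ : ℝ} {T : ℕ → Finset ι} {A sh : ℕ → ℝ → ι → ℝ} {S : ℕ → Finset σ} {piece : ℕ → ℝ → σ → ι → ℝ}
  {lvl : ℕ → σ → ℕ} {ρ Mlvl d : ℕ → ℝ} {θ κ₀ Q M₀ γ G : ℕ → ℝ → σ → ℝ}

/-- ★★ **THE PROJECTED-CENTRE ROAD (G34) IS A LEVEL LEDGER WITH DILATION CONSTANTS** (one run): §1 with the density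
`𝟙_{Kcut z}(w)·exp(−(½⟨w − μ z, Amat(w − μ z)⟩ + P z w))` (Gaussian mean `μ`, symmetric `Amat` with `γ‖x‖² ≤ ⟨x, Amat x⟩`, `P z`
`G`-Lipschitz on the convex kept cut `Kcut z`), the dilation taken about a measurable centre `c` with `c z ∈ Kcut z`, obtuse cross terms and
`2G∕γ`-farness at the shell ∩ cut points — `hmono` DISCHARGED per slot by G32 `hmono_of_projectedCentre`; envelope, transversality, odds,
[dict], (R) and the level letters displayed as in §1.  (= G34 `slotAntiConcentration_restrict_of_projectedCentre` per slot, monotonised and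
pushed.)  HYPOTHESES only; NE7c NOT proved. [folklore] -/
theorem levelLedger_of_projectedCentre
    (ζ : ∀ (K : ℕ) (_t : ℝ) (s : σ), Measure (X K s)) (hζ : ∀ K t s, SFinite (ζ K t s))
    (Kcut : ∀ (K : ℕ) (_t : ℝ) (s : σ), X K s → Set (κ K s → ℝ))
    (Amat : ∀ (K : ℕ) (_t : ℝ) (s : σ), Matrix (κ K s) (κ K s) ℝ) (hAsymm : ∀ K t s, (Amat K t s).IsSymm)
    (hγ0 : ∀ K t s, 0 < γ K t s) (hγ : ∀ K t s, ∀ x : κ K s → ℝ, γ K t s * ‖x‖ ^ 2 ≤ x ⬝ᵥ (Amat K t s *ᵥ x))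
    (μ : ∀ (K : ℕ) (_t : ℝ) (s : σ), X K s → (κ K s → ℝ))
    {c : ∀ (K : ℕ) (_t : ℝ) (s : σ), X K s → (κ K s → ℝ)} (hc : ∀ K t s, Measurable (c K t s))
    (P : ∀ (K : ℕ) (_t : ℝ) (s : σ), X K s → (κ K s → ℝ) → ℝ)
    (hg : ∀ K t s, Measurable fun p : X K s × (κ K s → ℝ) => (Kcut K t s p.1).indicator (fun w => ENNReal.ofReal (Real.exp
      (-(1 / 2 * ((w - μ K t s p.1) ⬝ᵥ (Amat K t s *ᵥ (w - μ K t s p.1))) + P K t s p.1 w)))) p.2)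
    (hfin : ∀ K t, |t| ≤ l₀ → ∀ s ∈ S K, IsFiniteMeasure (((ζ K t s).prod volume).withDensity fun p : X K s × (κ K s → ℝ) =>
      (Kcut K t s p.1).indicator (fun w => ENNReal.ofReal (Real.exp
        (-(1 / 2 * ((w - μ K t s p.1) ⬝ᵥ (Amat K t s *ᵥ (w - μ K t s p.1))) + P K t s p.1 w)))) p.2))
    {U : ∀ (K : ℕ) (_t : ℝ) (s : σ), X K s × (κ K s → ℝ) → ℝ} (hUm : ∀ K t s, Measurable (U K t s))
    {C Env : ∀ (K : ℕ) (_t : ℝ) (s : σ), Set (X K s × (κ K s → ℝ))}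
    (hC : ∀ K t s, MeasurableSet (C K t s)) (hEnv : ∀ K t s, MeasurableSet (Env K t s))
    (hθ : ∀ K t s, 0 < θ K t s) (hρ0 : ∀ j, 0 < ρ j) (hρ1 : ∀ j, ρ j < 1) (hκ : ∀ K t s, 0 < κ₀ K t s)
    (hQ0 : ∀ K t s, 0 ≤ Q K t s)
    (hK : ∀ K t s z, Convex ℝ (Kcut K t s z)) (hcK : ∀ K t s z, c K t s z ∈ Kcut K t s z)
    (hP : ∀ K t s z, ∀ v ∈ Kcut K t s z, ∀ v' ∈ Kcut K t s z, P K t s z v - P K t s z v' ≤ G K t s * ‖v - v'‖)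
    (hobt : ∀ K t, |t| ≤ l₀ → ∀ s ∈ S K, ∀ p : X K s × (κ K s → ℝ), θ K t s * (1 - ρ (lvl K s)) ≤ U K t s p → U K t s p < θ K t s →
      p ∈ C K t s → p.2 ∈ Kcut K t s p.1 → 0 ≤ (c K t s p.1 - μ K t s p.1) ⬝ᵥ (Amat K t s *ᵥ (p.2 - c K t s p.1)))
    (hfar : ∀ K t, |t| ≤ l₀ → ∀ s ∈ S K, ∀ p : X K s × (κ K s → ℝ), θ K t s * (1 - ρ (lvl K s)) ≤ U K t s p → U K t s p < θ K t s →
      p ∈ C K t s → p.2 ∈ Kcut K t s p.1 → 2 * G K t s ≤ γ K t s * ‖p.2 - c K t s p.1‖)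
    (henv : ∀ K t, |t| ≤ l₀ → ∀ s ∈ S K, ∀ l ∈ Icc (1 - 1 / ((Fintype.card (κ K s) : ℝ) + 1)) 1, ∀ p : X K s × (κ K s → ℝ),
      θ K t s * (1 - ρ (lvl K s)) ≤ U K t s p → U K t s p < θ K t s → p ∈ C K t s →
        (p.1, c K t s p.1 + l • (p.2 - c K t s p.1)) ∈ Env K t s)
    (hRT : ∀ K t, |t| ≤ l₀ → ∀ s ∈ S K, ∀ p : X K s × (κ K s → ℝ), θ K t s * (1 - ρ (lvl K s)) ≤ U K t s p → U K t s p < θ K t s →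
      p ∈ C K t s → ∀ r : ℝ, 1 ≤ r →
        θ K t s * (1 - ρ (lvl K s)) ≤ U K t s (p.1, c K t s p.1 + r • (p.2 - c K t s p.1)) →
        U K t s (p.1, c K t s p.1 + r • (p.2 - c K t s p.1)) < θ K t s → (p.1, c K t s p.1 + r • (p.2 - c K t s p.1)) ∈ C K t s →
          U K t s p + κ₀ K t s * (θ K t s * (1 - ρ (lvl K s))) * (r - 1) ≤ U K t s (p.1, c K t s p.1 + r • (p.2 - c K t s p.1)))
    (hQ : ∀ K t, |t| ≤ l₀ → ∀ s ∈ S K,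
      (((ζ K t s).prod volume).withDensity fun p : X K s × (κ K s → ℝ) => (Kcut K t s p.1).indicator (fun w => ENNReal.ofReal (Real.exp
        (-(1 / 2 * ((w - μ K t s p.1) ⬝ᵥ (Amat K t s *ᵥ (w - μ K t s p.1))) + P K t s p.1 w)))) p.2)
        (Env K t s \ ({p | U K t s p < θ K t s} ∩ C K t s))
      ≤ ENNReal.ofReal (Q K t s) *
        (((ζ K t s).prod volume).withDensity fun p : X K s × (κ K s → ℝ) => (Kcut K t s p.1).indicator (fun w => ENNReal.ofReal (Real.exp
          (-(1 / 2 * ((w - μ K t s p.1) ⬝ᵥ (Amat K t s *ᵥ (w - μ K t s p.1))) + P K t s p.1 w)))) p.2)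
          ({p | U K t s p < θ K t s} ∩ C K t s))
    (hM₀ : ∀ K t, |t| ≤ l₀ → ∀ s ∈ S K, 0 ≤ M₀ K t s)
    (hpiece : ∀ K t, |t| ≤ l₀ → ∀ s ∈ S K, ∑ τ ∈ T K, piece K t s τ ≤ M₀ K t s *
      (((((ζ K t s).prod volume).withDensity fun p : X K s × (κ K s → ℝ) => (Kcut K t s p.1).indicator (fun w => ENNReal.ofReal (Real.exp
        (-(1 / 2 * ((w - μ K t s p.1) ⬝ᵥ (Amat K t s *ᵥ (w - μ K t s p.1))) + P K t s p.1 w)))) p.2).restrict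
          ({p | U K t s p < θ K t s} ∩ C K t s)) {p | θ K t s * (1 - ρ (lvl K s)) ≤ U K t s p ∧ U K t s p < θ K t s}).toReal)
    (hAw : ∀ K t, |t| ≤ l₀ → ∀ s ∈ S K, M₀ K t s *
      (((((ζ K t s).prod volume).withDensity fun p : X K s × (κ K s → ℝ) => (Kcut K t s p.1).indicator (fun w => ENNReal.ofReal (Real.exp
        (-(1 / 2 * ((w - μ K t s p.1) ⬝ᵥ (Amat K t s *ᵥ (w - μ K t s p.1))) + P K t s p.1 w)))) p.2).restrict
          ({p | U K t s p < θ K t s} ∩ C K t s)) univ).toReal ≤ ∑ τ ∈ T K, A K t τ)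
    (sh_nonneg : ∀ K t, |t| ≤ l₀ → ∀ τ ∈ T K, 0 ≤ sh K t τ) (sh_le : ∀ K t, |t| ≤ l₀ → ∀ τ ∈ T K, sh K t τ ≤ A K t τ)
    (cover : ∀ K t, |t| ≤ l₀ → ∀ τ ∈ T K, sh K t τ ≤ ∑ s ∈ S K, piece K t s τ)
    (hM0 : ∀ j, 0 ≤ Mlvl j) (hMlvl : ∀ K t, |t| ≤ l₀ → ∀ s ∈ S K, (1 + Q K t s) / κ₀ K t s ≤ Mlvl (lvl K s))
    (hd0 : ∀ j, 0 ≤ d j) (hd : ∀ K, ∀ s ∈ S K, (Fintype.card (κ K s) : ℝ) ≤ d (lvl K s)) :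
    LevelLedger l₀ T A sh S piece lvl (fun j => Mlvl j * (3 * (d j + 1) / (1 - ρ j))) ρ := by
  have hl₀ : ∀ K s, (0 : ℝ) ≤ 1 - 1 / ((Fintype.card (κ K s) : ℝ) + 1) := fun K s => by
    rw [sub_nonneg, div_le_one (by positivity)]
    linarith [show (0 : ℝ) ≤ Fintype.card (κ K s) from Nat.cast_nonneg _]
  exact levelLedger_of_recentredDilation ζ hζ hc hg hfin hUm hC hEnv hθ hρ0 hρ1 hκ hQ0 henv
    (fun K t ht s hs => hmono_of_projectedCentre (Kcut K t s) (Amat K t s) (hAsymm K t s) (hγ0 K t s) (hγ K t s) (μ K t s)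
      (c K t s) (P K t s) (U K t s) (C K t s) (hl₀ K s) (hK K t s) (hcK K t s) (hP K t s) (hobt K t ht s hs) (hfar K t ht s hs))
    hRT hQ hM₀ hpiece hAw sh_nonneg sh_le cover hM0 hMlvl hd0 hd

end ProjectedCentre

/-! ## §4 A2 ∕ A6: every binder of §1 discharged on one live slot per step -/

section Sanity

open N21CollarOddsBlockFrame (isFiniteMeasure_blockGaussianWeight)

/-- **EVERY BINDER OF `levelLedger_of_recentredDilation` DISCHARGED ON ONE LIVE SLOT PER STEP (A2 ∕ A6).**  Data: `σ = ι = Unit`,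
`S K = T K = {()}`, `lvl K () = K`; frame `Unit × (Fin 1 → ℝ)`, `ζ = dirac ()`, Gaussian weight, `m = 0`, `U p = |p.2 0|`, `C = univ`,
`Env = {U < 1}`, `θ = 1`, `ρ ≡ ½`, `κ₀ = 1`, `Q = 0`, `M₀ = 1`; the slot's piece and the term weight are the cut law's shell ∕ total mass (so
the [dict] push holds with equality), `sh = piece`; level letters `M ≡ 1`, `d ≡ 1`.  The road binders: `henv` (contractions of a shell point
stay below the threshold), `hmono` (the Gaussian weight does not collapse under contraction toward `0`), `hRT` (`|r·w₀| = |w₀| + (r−1)|w₀| ≥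
|w₀| + (r−1)·½` on the shell), `hQ` (EMPTY envelope excess) — all proved here; finiteness by n21-e's `isFiniteMeasure_blockGaussianWeight`.
(v1.2 NOTE, ref-O g2 READ-41: here the delivered inequality is numerically trivial, `D·ρ = 6 ≥ 1` — a satisfiability witness, not a sharpness test.) [textbook] -/
theorem recentredDilationLedger_binders_inhabited (l₀ : ℝ) :
    LevelLedger l₀ (fun _ : ℕ => ({()} : Finset Unit))
      (fun (_ : ℕ) (_ : ℝ) (_ : Unit) =>
        (((((Measure.dirac ()).prod (volume : Measure (Fin 1 → ℝ))).withDensity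
            fun p : Unit × (Fin 1 → ℝ) => ENNReal.ofReal (Real.exp (-(∑ i, p.2 i ^ 2 / 2)))).restrict
          ({p : Unit × (Fin 1 → ℝ) | |p.2 0| < 1} ∩ univ)) univ).toReal)
      (fun (_ : ℕ) (_ : ℝ) (_ : Unit) =>
        (((((Measure.dirac ()).prod (volume : Measure (Fin 1 → ℝ))).withDensity
            fun p : Unit × (Fin 1 → ℝ) => ENNReal.ofReal (Real.exp (-(∑ i, p.2 i ^ 2 / 2)))).restrict
          ({p : Unit × (Fin 1 → ℝ) | |p.2 0| < 1} ∩ univ)) {p | 1 * (1 - 1 / 2) ≤ |p.2 0| ∧ |p.2 0| < 1}).toReal)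
      (fun _ : ℕ => ({()} : Finset Unit))
      (fun (_ : ℕ) (_ : ℝ) (_ : Unit) (_ : Unit) =>
        (((((Measure.dirac ()).prod (volume : Measure (Fin 1 → ℝ))).withDensity
            fun p : Unit × (Fin 1 → ℝ) => ENNReal.ofReal (Real.exp (-(∑ i, p.2 i ^ 2 / 2)))).restrict
          ({p : Unit × (Fin 1 → ℝ) | |p.2 0| < 1} ∩ univ)) {p | 1 * (1 - 1 / 2) ≤ |p.2 0| ∧ |p.2 0| < 1}).toReal)
      (fun (K : ℕ) (_ : Unit) => K) (fun j => (fun _ : ℕ => (1 : ℝ)) j * (3 * ((fun _ : ℕ => (1 : ℝ)) j + 1) / (1 - (fun _ : ℕ => (1 / 2 : ℝ)) j)))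
      (fun _ : ℕ => (1 / 2 : ℝ)) := by
  -- measurability of the frame data
  have hA : Measurable fun p : Unit × (Fin 1 → ℝ) => ∑ i, p.2 i ^ 2 / 2 :=
    Finset.measurable_sum _ fun i _ => (((measurable_pi_apply i).comp measurable_snd).pow_const 2).div_const 2
  have hg : Measurable fun p : Unit × (Fin 1 → ℝ) => ENNReal.ofReal (Real.exp (-(∑ i, p.2 i ^ 2 / 2))) :=
    ENNReal.measurable_ofReal.comp (Real.measurable_exp.comp hA.neg)
  have hU : Measurable fun p : Unit × (Fin 1 → ℝ) => |p.2 0| := ((measurable_pi_apply 0).comp measurable_snd).abs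
  have hEnv : MeasurableSet {p : Unit × (Fin 1 → ℝ) | |p.2 0| < 1} := measurableSet_lt hU measurable_const
  have hfin := isFiniteMeasure_blockGaussianWeight (κ := Fin 1)
  have hl01 : ∀ l ∈ Icc (1 - 1 / ((Fintype.card (Fin 1) : ℝ) + 1)) (1 : ℝ), 0 ≤ l ∧ l ≤ 1 := by
    intro l hl
    have h := hl.1
    simp only [Fintype.card_fin, Nat.cast_one] at h
    exact ⟨by linarith, hl.2⟩
  refine levelLedger_of_recentredDilation (X := fun _ _ => Unit) (κ := fun _ _ => Fin 1)
    (θ := fun _ _ _ => 1) (κ₀ := fun _ _ _ => 1) (Q := fun _ _ _ => 0) (M₀ := fun _ _ _ => 1)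
    (Mlvl := fun _ => 1) (d := fun _ => 1)
    (fun _ _ _ => Measure.dirac ()) (fun _ _ _ => inferInstance)
    (m := fun _ _ _ _ => 0) (fun _ _ _ => measurable_const)
    (g := fun _ _ _ p => ENNReal.ofReal (Real.exp (-(∑ i, p.2 i ^ 2 / 2)))) (fun _ _ _ => hg) (fun _ _ _ _ _ => hfin)
    (U := fun _ _ _ p => |p.2 0|) (fun _ _ _ => hU)
    (C := fun _ _ _ => univ) (Env := fun _ _ _ => {p | |p.2 0| < 1}) (fun _ _ _ => MeasurableSet.univ) (fun _ _ _ => hEnv)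
    (fun _ _ _ => one_pos) (fun _ => by norm_num) (fun _ => by norm_num) (fun _ _ _ => one_pos) (fun _ _ _ => le_rfl)
    ?_ ?_ ?_ ?_ (fun _ _ _ _ _ => zero_le_one) ?_ ?_ ?_ ?_ ?_ (fun _ => zero_le_one) (fun _ _ _ _ _ => by norm_num)
    (fun _ => zero_le_one) (fun _ _ _ => by simp)
  · -- henv: contractions of a shell point stay below the threshold
    intro K t _ s _ l hl p _ h2 _
    obtain ⟨hl0, hl1⟩ := hl01 l hl
    have h2' : |p.2 0| < 1 := h2
    simp only [zero_add, sub_zero, mem_setOf_eq, Pi.smul_apply, smul_eq_mul]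
    rw [abs_mul, abs_of_nonneg hl0]
    exact lt_of_le_of_lt (mul_le_of_le_one_left (abs_nonneg _) hl1) h2'
  · -- hmono: the Gaussian weight does not collapse under contraction toward `0`
    intro K t _ s _ l hl p _ _ _
    obtain ⟨hl0, hl1⟩ := hl01 l hl
    simp only [zero_add, sub_zero]
    refine ENNReal.ofReal_le_ofReal (Real.exp_le_exp.2 (neg_le_neg (Finset.sum_le_sum fun i _ => ?_)))
    simp only [Pi.smul_apply, smul_eq_mul]
    nlinarith [mul_nonneg (mul_nonneg hl0 hl0) (sq_nonneg (p.2 i)), sq_nonneg (p.2 i), mul_le_one₀ hl1 hl0 hl1]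
  · -- hRT: `U = |w₀|` is radially transversal with `κ₀ = 1` on the shell `{½ ≤ U}`
    intro K t _ s _ p h1 _ _ r hr _ _ _
    have h1' : 1 * (1 - 1 / 2) ≤ |p.2 0| := h1
    simp only [zero_add, sub_zero, Pi.smul_apply, smul_eq_mul]
    rw [abs_mul, abs_of_nonneg (by linarith : (0 : ℝ) ≤ r)]
    nlinarith
  · -- hQ: the envelope excess is EMPTY
    intro K t _ s _
    have he : ({p : Unit × (Fin 1 → ℝ) | |p.2 0| < 1} \ ({p : Unit × (Fin 1 → ℝ) | |p.2 0| < 1} ∩ univ)) = ∅ := by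
      ext p
      simp
    simp only [he, measure_empty, zero_le]
  · -- hpiece: the slot's piece IS the shell mass (M₀ = 1)
    intro K t _ s _
    simp
  · -- hAw: the term weight IS the total mass (M₀ = 1)
    intro K t _ s _
    simp
  · -- sh_nonneg
    intro K t _ τ _
    exact ENNReal.toReal_nonneg
  · -- sh_le: shell mass ≤ total mass of the (finite) cut law
    intro K t _ τ _
    haveI := hfin
    exact ENNReal.toReal_mono (measure_ne_top _ _) (measure_mono (subset_univ _))
  · -- cover: the single slot's piece covers the shell part
    intro K t _ τ _
    simp

/-- the witness is LIVE: every step has one slot and one term (not the no-slot ledger). [textbook] -/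
theorem recentredDilationLedger_witness_live (K : ℕ) :
    ((fun _ : ℕ => ({()} : Finset Unit)) K).Nonempty ∧ (fun (K : ℕ) (_ : Unit) => K) K () = K :=
  ⟨⟨(), Finset.mem_singleton_self _⟩, rfl⟩

end Sanity

/-! ## §5 (v1.1) One run: G31's low-centre setting, `hmono` discharged by convexity + lowness -/
section LowCentre

open N21LowCentreNonCollapse (hmono_of_lowCentre)

variable {ι σ : Type*} {X : ℕ → σ → Type*} [∀ K s, MeasurableSpace (X K s)] {κ : ℕ → σ → Type*}
  [∀ K s, Fintype (κ K s)] [∀ K s, Nonempty (κ K s)]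
  {l₀ : ℝ} {T : ℕ → Finset ι} {A sh : ℕ → ℝ → ι → ℝ} {S : ℕ → Finset σ} {piece : ℕ → ℝ → σ → ι → ℝ}
  {lvl : ℕ → σ → ℕ} {ρ Mlvl d : ℕ → ℝ} {θ κ₀ Q M₀ : ℕ → ℝ → σ → ℝ}

/-- ★★ **THE LOW-CENTRE ROAD (G31) IS A LEVEL LEDGER WITH DILATION CONSTANTS** (one run): §1 with the density `𝟙_{Kcut z}(w)·e^{−φ_z(w)}` (`φ_z`
convex on the convex kept cut), dilation about a measurable LOW centre `m z ∈ Kcut z` (`φ_z(m z) ≤ φ_z(m z + (1 − 1∕(#κ+1))•(w − m z))` on the shell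
∩ cut) — `hmono` DISCHARGED per slot by G30 `hmono_of_lowCentre` (= G31 per slot, monotonised and pushed).  HYPOTHESES only; NE7c NOT proved. [folklore] -/
theorem levelLedger_of_lowCentre
    (ζ : ∀ (K : ℕ) (_t : ℝ) (s : σ), Measure (X K s)) (hζ : ∀ K t s, SFinite (ζ K t s))
    {m : ∀ (K : ℕ) (_t : ℝ) (s : σ), X K s → (κ K s → ℝ)} (hm : ∀ K t s, Measurable (m K t s))
    (Kcut : ∀ (K : ℕ) (_t : ℝ) (s : σ), X K s → Set (κ K s → ℝ)) (φ : ∀ (K : ℕ) (_t : ℝ) (s : σ), X K s → (κ K s → ℝ) → ℝ)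
    (hg : ∀ K t s, Measurable fun p : X K s × (κ K s → ℝ) =>
      (Kcut K t s p.1).indicator (fun w => ENNReal.ofReal (Real.exp (-φ K t s p.1 w))) p.2)
    (hfin : ∀ K t, |t| ≤ l₀ → ∀ s ∈ S K, IsFiniteMeasure (((ζ K t s).prod volume).withDensity fun p : X K s × (κ K s → ℝ) =>
      (Kcut K t s p.1).indicator (fun w => ENNReal.ofReal (Real.exp (-φ K t s p.1 w))) p.2))
    {U : ∀ (K : ℕ) (_t : ℝ) (s : σ), X K s × (κ K s → ℝ) → ℝ} (hUm : ∀ K t s, Measurable (U K t s))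
    {C Env : ∀ (K : ℕ) (_t : ℝ) (s : σ), Set (X K s × (κ K s → ℝ))} (hC : ∀ K t s, MeasurableSet (C K t s)) (hEnv : ∀ K t s, MeasurableSet (Env K t s))
    (hθ : ∀ K t s, 0 < θ K t s) (hρ0 : ∀ j, 0 < ρ j) (hρ1 : ∀ j, ρ j < 1) (hκ : ∀ K t s, 0 < κ₀ K t s) (hQ0 : ∀ K t s, 0 ≤ Q K t s)
    (hK : ∀ K t s z, Convex ℝ (Kcut K t s z)) (hφ : ∀ K t s z, ConvexOn ℝ (Kcut K t s z) (φ K t s z)) (hmK : ∀ K t s z, m K t s z ∈ Kcut K t s z)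
    (hlow : ∀ K t, |t| ≤ l₀ → ∀ s ∈ S K, ∀ p : X K s × (κ K s → ℝ), θ K t s * (1 - ρ (lvl K s)) ≤ U K t s p → U K t s p < θ K t s →
      p ∈ C K t s → p.2 ∈ Kcut K t s p.1 →
        φ K t s p.1 (m K t s p.1) ≤ φ K t s p.1 (m K t s p.1 + (1 - 1 / ((Fintype.card (κ K s) : ℝ) + 1)) • (p.2 - m K t s p.1)))
    (henv : ∀ K t, |t| ≤ l₀ → ∀ s ∈ S K, ∀ l ∈ Icc (1 - 1 / ((Fintype.card (κ K s) : ℝ) + 1)) 1, ∀ p : X K s × (κ K s → ℝ),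
      θ K t s * (1 - ρ (lvl K s)) ≤ U K t s p → U K t s p < θ K t s → p ∈ C K t s →
        (p.1, m K t s p.1 + l • (p.2 - m K t s p.1)) ∈ Env K t s)
    (hRT : ∀ K t, |t| ≤ l₀ → ∀ s ∈ S K, ∀ p : X K s × (κ K s → ℝ), θ K t s * (1 - ρ (lvl K s)) ≤ U K t s p → U K t s p < θ K t s →
      p ∈ C K t s → ∀ r : ℝ, 1 ≤ r →
        θ K t s * (1 - ρ (lvl K s)) ≤ U K t s (p.1, m K t s p.1 + r • (p.2 - m K t s p.1)) →
        U K t s (p.1, m K t s p.1 + r • (p.2 - m K t s p.1)) < θ K t s → (p.1, m K t s p.1 + r • (p.2 - m K t s p.1)) ∈ C K t s →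
          U K t s p + κ₀ K t s * (θ K t s * (1 - ρ (lvl K s))) * (r - 1) ≤ U K t s (p.1, m K t s p.1 + r • (p.2 - m K t s p.1)))
    (hQ : ∀ K t, |t| ≤ l₀ → ∀ s ∈ S K,
      (((ζ K t s).prod volume).withDensity fun p : X K s × (κ K s → ℝ) =>
          (Kcut K t s p.1).indicator (fun w => ENNReal.ofReal (Real.exp (-φ K t s p.1 w))) p.2) (Env K t s \ ({p | U K t s p < θ K t s} ∩ C K t s))
      ≤ ENNReal.ofReal (Q K t s) * (((ζ K t s).prod volume).withDensity fun p : X K s × (κ K s → ℝ) =>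
          (Kcut K t s p.1).indicator (fun w => ENNReal.ofReal (Real.exp (-φ K t s p.1 w))) p.2) ({p | U K t s p < θ K t s} ∩ C K t s))
    (hM₀ : ∀ K t, |t| ≤ l₀ → ∀ s ∈ S K, 0 ≤ M₀ K t s)
    (hpiece : ∀ K t, |t| ≤ l₀ → ∀ s ∈ S K, ∑ τ ∈ T K, piece K t s τ ≤ M₀ K t s *
      (((((ζ K t s).prod volume).withDensity fun p : X K s × (κ K s → ℝ) =>
          (Kcut K t s p.1).indicator (fun w => ENNReal.ofReal (Real.exp (-φ K t s p.1 w))) p.2).restrict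
          ({p | U K t s p < θ K t s} ∩ C K t s)) {p | θ K t s * (1 - ρ (lvl K s)) ≤ U K t s p ∧ U K t s p < θ K t s}).toReal)
    (hAw : ∀ K t, |t| ≤ l₀ → ∀ s ∈ S K, M₀ K t s *
      (((((ζ K t s).prod volume).withDensity fun p : X K s × (κ K s → ℝ) =>
          (Kcut K t s p.1).indicator (fun w => ENNReal.ofReal (Real.exp (-φ K t s p.1 w))) p.2).restrict
          ({p | U K t s p < θ K t s} ∩ C K t s)) univ).toReal ≤ ∑ τ ∈ T K, A K t τ)
    (sh_nonneg : ∀ K t, |t| ≤ l₀ → ∀ τ ∈ T K, 0 ≤ sh K t τ) (sh_le : ∀ K t, |t| ≤ l₀ → ∀ τ ∈ T K, sh K t τ ≤ A K t τ)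
    (cover : ∀ K t, |t| ≤ l₀ → ∀ τ ∈ T K, sh K t τ ≤ ∑ s ∈ S K, piece K t s τ) (hM0 : ∀ j, 0 ≤ Mlvl j)
    (hMlvl : ∀ K t, |t| ≤ l₀ → ∀ s ∈ S K, (1 + Q K t s) / κ₀ K t s ≤ Mlvl (lvl K s)) (hd0 : ∀ j, 0 ≤ d j) (hd : ∀ K, ∀ s ∈ S K, (Fintype.card (κ K s) : ℝ) ≤ d (lvl K s)) :
    LevelLedger l₀ T A sh S piece lvl (fun j => Mlvl j * (3 * (d j + 1) / (1 - ρ j))) ρ := by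
  have hl₀ : ∀ K s, (0 : ℝ) < 1 - 1 / ((Fintype.card (κ K s) : ℝ) + 1) := fun K s => by
    have hcard : (1 : ℝ) ≤ (Fintype.card (κ K s) : ℝ) := by exact_mod_cast Fintype.card_pos
    have h1 : 1 / ((Fintype.card (κ K s) : ℝ) + 1) < 1 := by rw [div_lt_one (by positivity)]; linarith
    linarith
  exact levelLedger_of_recentredDilation ζ hζ hm hg hfin hUm hC hEnv hθ hρ0 hρ1 hκ hQ0 henv
    (fun K t ht s hs => hmono_of_lowCentre (Kcut K t s) (φ K t s) (m K t s) (U K t s) (C K t s) (hK K t s) (hφ K t s) (hmK K t s)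
      (hl₀ K s) (hlow K t ht s hs))
    hRT hQ hM₀ hpiece hAw sh_nonneg sh_le cover hM0 hMlvl hd0 hd

end LowCentre

end Summit.QuantumFields.YangMills.Theorems.N21RecentredRoadLevelLedger
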